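import Mathlib.Analysis.SpecialFunctions.Gaussian.GaussianIntegral
import Mathlib.MeasureTheory.Integral.Pi
import Literature.MathematicalPhysics.KineticTheory.InfiniteChainSeveredGibbs
import HarnessLib

/-!
# The finite-volume Gibbs distributions of a confining chain are normalisable (LLL condition B2)

Topic `Literature/MathematicalPhysics/KineticTheory`; proofs-only companion of
`InfiniteChainDynamics.lean` (`OscillatorChain.CondB2`, the PREDICATE "every finite-volume Gibbs
distribution `γ_Λ(· | η)` (LLL (14)) is a probability measure") and `InfiniteChainSeveredGibbs.lean`
(`hamiltonianIn_chain`). Lanford–Lebowitz–Lieb 1977, §4, condition B2 is an ASSUMPTION of their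
Theorem 3; for the chains of the tree it is a theorem, proved here:

* `condB2_of_integrable_exp_neg` — for `T > 0`, `U, V` continuous, `V ≥ 0` and `e^{-U/T} ∈ L¹(dq)`,
  `P.CondB2 T` holds: `chainSpecification T Λ η` is the `Measure.tilted` of the (nonzero, infinite)
  a priori measure `(dq dp)^{⊗Λ} ⊗ δ_η` by `-H_Λ/T`, and `e^{-H_Λ/T} ≤ ∏_{x∈Λ} e^{-(p_x²/2+U(q_x))/T}`
  (`V ≥ 0`, `hamiltonianIn_chain`) is integrable (`Integrable.fintype_prod`, Gaussian momentum
  factor), so Mathlib's `isProbabilityMeasure_tilted` applies and the junk value `0` is not hit;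
* `condB2_pinnedChain` — the tree's `pinnedChain ω₂ lam β γ` (`ω₂ > 0`, `lam, β ≥ 0`) satisfies B2
  at every `T > 0`.

This discharges the hypothesis `hB2 : P.CondB2 T` of `map_snd_eq_gaussianReal`,
`lintegral_exp_sq_snd` (`InfiniteChainGibbsMomenta.lean`) and of every DLR computation that needs the
kernels to be genuine conditional probabilities (existence / uniqueness of Gibbs states of the
pinned chain). [cite: LanfordLebowitzLieb1977, §4 condition B2]
-/

noncomputable section

open MeasureTheory Filter Topology Set Real Literature.Probability.LatticeModels
open scoped ENNReal

namespace Literature.MathematicalPhysics.KineticTheory.HeatConduction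

namespace OscillatorChain

variable (P : OscillatorChain)

/-- The one-particle Boltzmann weight `e^{-(p²/2 + U(q))/T}` is Lebesgue integrable on `ℝ × ℝ` as
soon as `e^{-U/T}` is integrable and `T > 0` (Gaussian momentum factor). [folklore] -/
theorem integrable_exp_neg_siteEnergy {T : ℝ} (hT : 0 < T)
    (hUint : Integrable (fun q : ℝ => exp (-P.U q / T))) :
    Integrable (fun z : ℝ × ℝ => exp (-(z.2 ^ 2 / 2 + P.U z.1) / T)) := by
  have hp : Integrable (fun p : ℝ => exp (-(1 / (2 * T)) * p ^ 2)) :=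
    integrable_exp_neg_mul_sq (by positivity)
  have h := hUint.mul_prod hp
  rw [← Measure.volume_eq_prod] at h
  refine h.congr (Eventually.of_forall fun z => ?_)
  simp only
  rw [← Real.exp_add]
  congr 1
  field_simp
  ring

/-- A lower bound for the finite-volume Hamiltonian when `V ≥ 0`: `H_Λ ≥ Σ_{x∈Λ} (p_x²/2 + U(q_x))`.
[folklore] -/
theorem sum_siteEnergy_le_hamiltonianIn (hV0 : ∀ r, 0 ≤ P.V r) (Λ : Finset ℤ) (σ : ChainConfig) :
    ∑ x ∈ Λ, ((σ x).2 ^ 2 / 2 + P.U (σ x).1) ≤ hamiltonianIn P.chainPotential chainSupp Λ σ := by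
  rw [hamiltonianIn_chain]
  have : 0 ≤ ∑ y ∈ bondSet Λ, P.V ((σ (y + 1)).1 - (σ y).1) :=
    Finset.sum_nonneg fun y _ => hV0 _
  linarith

/-- **LLL 1977 condition B2 for confining chains.** If `T > 0`, `U` and `V` are continuous,
`V ≥ 0` and `e^{-U/T}` is Lebesgue integrable, then every finite-volume Gibbs distribution
`γ_Λ(· | η)` of the chain (`chainSpecification`, LLL (14)) is a probability measure: the
normaliser `Z_Λ(η) = ∫ e^{-H_Λ/T}` is finite (domination by the product of one-particle weights,
`V ≥ 0`) and positive (the a priori measure is nonzero), so Mathlib's `Measure.tilted` junk value is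
not hit. [cite: LanfordLebowitzLieb1977, §4 condition B2] -/
theorem condB2_of_integrable_exp_neg {T : ℝ} (hT : 0 < T) (hU : Continuous P.U)
    (hV : Continuous P.V) (hV0 : ∀ r, 0 ≤ P.V r)
    (hUint : Integrable (fun q : ℝ => exp (-P.U q / T))) : P.CondB2 T := by
  intro Λ η
  -- notation
  set pi : Measure (Λ → ℝ × ℝ) := Measure.pi fun _ : Λ => (volume : Measure (ℝ × ℝ)) with hpi
  set ν : Measure ChainConfig := pi.map (glueWith Λ · η) with hν
  set f : ChainConfig → ℝ := fun σ => -T⁻¹ * hamiltonianIn P.chainPotential chainSupp Λ σ with hf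
  change IsProbabilityMeasure (ν.tilted f)
  -- the a priori measure is nonzero
  haveI : NeZero ν := by
    refine ⟨fun h0 => ?_⟩
    have h1 : ν univ = 0 := by rw [h0, Measure.coe_zero, Pi.zero_apply]
    rw [hν, Measure.map_apply (measurable_glueWith Λ η) MeasurableSet.univ, preimage_univ,
      hpi, Measure.pi_univ] at h1
    refine absurd h1 (Finset.prod_ne_zero_iff.2 fun i _ => ?_)
    exact NeZero.ne _
  -- integrability of `e^f`
  refine isProbabilityMeasure_tilted ?_
  have hfm : Measurable fun σ : ChainConfig => exp (f σ) :=
    measurable_exp.comp (measurable_const.mul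
      (P.continuous_hamiltonianIn_chain hU hV Λ).measurable)
  rw [hν, integrable_map_measure hfm.aestronglyMeasurable
    (measurable_glueWith Λ η).aemeasurable]
  -- domination by the product of one-particle weights
  set w : ℝ × ℝ → ℝ := fun z => exp (-(z.2 ^ 2 / 2 + P.U z.1) / T) with hw
  have hwint : Integrable w := P.integrable_exp_neg_siteEnergy hT hUint
  have hprod : Integrable (fun ζ : Λ → ℝ × ℝ => ∏ i, w (ζ i)) pi :=
    Integrable.fintype_prod (fun _ => hwint)
  refine hprod.mono' ((hfm.comp (measurable_glueWith Λ η)).aestronglyMeasurable)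
    (Eventually.of_forall fun ζ => ?_)
  rw [Function.comp_apply, Real.norm_eq_abs, abs_of_pos (exp_pos _)]
  -- `e^{f(glue ζ η)} ≤ ∏ w(ζ i)`
  have hsum : ∑ x ∈ Λ, (((glueWith Λ ζ η) x).2 ^ 2 / 2 + P.U ((glueWith Λ ζ η) x).1) =
      ∑ i : Λ, ((ζ i).2 ^ 2 / 2 + P.U (ζ i).1) := by
    rw [← Finset.sum_coe_sort]
    refine Finset.sum_congr rfl fun i _ => ?_
    rw [glueWith_apply_mem Λ ζ η i.2]
  have hprodexp : ∏ i, w (ζ i) = exp (-T⁻¹ * ∑ i : Λ, ((ζ i).2 ^ 2 / 2 + P.U (ζ i).1)) := by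
    rw [Finset.mul_sum, Real.exp_sum]
    refine Finset.prod_congr rfl fun i _ => ?_
    rw [hw]
    field_simp
  rw [hprodexp]
  refine exp_le_exp.2 ?_
  rw [hf]
  have hle := P.sum_siteEnergy_le_hamiltonianIn hV0 Λ (glueWith Λ ζ η)
  rw [hsum] at hle
  have hTinv : 0 < T⁻¹ := inv_pos.2 hT
  nlinarith

/-- **Condition B2 for the pinned anharmonic chain**: for `ω₂ > 0`, `lam ≥ 0`, `β ≥ 0` and every
`T > 0`, all finite-volume Gibbs distributions of `pinnedChain ω₂ lam β γ` are probability measures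
(`U(q) = ω₂q²/2 + lam q⁴/4 ≥ ω₂q²/2` gives a Gaussian majorant of `e^{-U/T}`, `V = r²/2 + βr⁴/4 ≥ 0`).
[cite: LanfordLebowitzLieb1977, §4 condition B2] -/
theorem condB2_pinnedChain {ω₂ lam β : ℝ} (γ : ℝ) (hω : 0 < ω₂) (hl : 0 ≤ lam) (hβ : 0 ≤ β)
    {T : ℝ} (hT : 0 < T) : (pinnedChain ω₂ lam β γ).CondB2 T := by
  refine (pinnedChain ω₂ lam β γ).condB2_of_integrable_exp_neg hT ?_ ?_ ?_ ?_
  · show Continuous fun q : ℝ => ω₂ * q ^ 2 / 2 + lam * q ^ 4 / 4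
    fun_prop
  · show Continuous fun r : ℝ => r ^ 2 / 2 + β * r ^ 4 / 4
    fun_prop
  · intro r
    show 0 ≤ r ^ 2 / 2 + β * r ^ 4 / 4
    positivity
  · have hg : Integrable (fun q : ℝ => exp (-(ω₂ / (2 * T)) * q ^ 2)) :=
      integrable_exp_neg_mul_sq (by positivity)
    refine hg.mono' (by fun_prop) (Eventually.of_forall fun q => ?_)
    rw [Real.norm_eq_abs, abs_of_pos (exp_pos _)]
    refine exp_le_exp.2 ?_
    show -(ω₂ * q ^ 2 / 2 + lam * q ^ 4 / 4) / T ≤ -(ω₂ / (2 * T)) * q ^ 2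
    rw [div_le_iff₀ hT]
    have h1 : 0 ≤ lam * q ^ 4 / 4 := by positivity
    have h2 : -(ω₂ / (2 * T)) * q ^ 2 * T = -(ω₂ * q ^ 2 / 2) := by field_simp
    rw [h2]
    linarith

end OscillatorChain

end Literature.MathematicalPhysics.KineticTheory.HeatConduction

end
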